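import Summits.RiemannHypothesis.RiemannHypothesis.Theorems.SpectralTraceFloorFeedbackDefs
import Mathlib.Analysis.Fourier.FourierTransformDeriv
import HarnessLib

/-!
# RiemannHypothesis / SpectralTrace — `WindowStep`, line `floor-feedback`: calibration of the held stub (co-lead c1)

Crux `WindowStep` (stmt-RiemannHypothesis-14659), line `floor-feedback`, held stub
`stub_quietLadder : ∀ n ≥ 2, QuietRung (log n)` (registered by lead session 1).  This file lands the small,
RH-free facts about the objects in `QuietRung` that the line card states as numbers and that every discussion of the
held stub uses:

* `abs_le_of_isFloorFeedback` — a floor–feedback solution is a priori bounded, `|h| ≤ ‖k‖₁`;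
* `abs_floor_sub_le_of_isFloorFeedback` — hence a floor–feedback family has BOUNDED DISCREPANCY from its model count,
  `|⌊Φ + h⌋ − Φ| ≤ ‖k‖₁ + 1` (so, e.g., no family of the line at any level is ζ's family of ordinates, whose discrepancy
  `S(T)` from the smooth count is unbounded);
* `le_slopeBudget_of_isFeedbackKernel` — the honest Bernstein floor of an admissible kernel, `A ≤ ‖k′‖₁`
  (`𝓕(k′)(w) = 2πi w 𝓕k(w) = iA` at the band edge `w = A/2π`, and `|𝓕(k′)| ≤ ‖k′‖₁`);
* `exp_le_quietHeight_of_isFeedbackKernel` — hence the handover height of a quiet rung is at least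
  `exp(2π C⋆(A) + π A)` (`= 2π e^{π/5} e^{2M(A)} e^{πA}`, i.e. `≥ 104` at level `log 2`), whatever the kernel
  (registered helper `quietHeight_floor`).

Nothing here is RH-strength; the held stub itself is not touched.
-/

noncomputable section

open Complex Filter Set MeasureTheory
open scoped Real Topology FourierTransform SchwartzMap

set_option linter.dupNamespace false

namespace Summit.RiemannHypothesis.RiemannHypothesis.Theorems.FloorFeedback

open Literature.NumberTheory.LFunctions

/-! ## Bounded feedback, bounded discrepancy -/

/-- A floor–feedback solution is a priori bounded by `‖k‖₁`: `|h(T)| = |∫ k(T−s) fract(Φ(s)+h(s)) ds| ≤ ∫ |k|`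
(`0 ≤ fract < 1`, translation invariance of Lebesgue measure). [folklore] -/
theorem abs_le_of_isFloorFeedback {Φ h : ℝ → ℝ} {k : 𝓢(ℝ, ℝ)} (hfb : IsFloorFeedback Φ h k) (T : ℝ) :
    |h T| ≤ ∫ s, |k s| := by
  rw [hfb.2 T]
  have hint : Integrable (fun s : ℝ => |k (T - s)|) :=
    ((k.integrable (μ := volume)).norm).comp_sub_left T
  calc |∫ s, k (T - s) * Int.fract (Φ s + h s)|
      ≤ ∫ s, |k (T - s)| := by
        have h1 : ‖∫ s, k (T - s) * Int.fract (Φ s + h s)‖ ≤ ∫ s, |k (T - s)| := by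
          refine norm_integral_le_of_norm_le hint (Eventually.of_forall fun s => ?_)
          rw [Real.norm_eq_abs, abs_mul]
          have h0 : 0 ≤ Int.fract (Φ s + h s) := Int.fract_nonneg _
          have h1 : Int.fract (Φ s + h s) < 1 := Int.fract_lt_one _
          rw [abs_of_nonneg h0]
          nlinarith [abs_nonneg (k (T - s))]
        simpa [Real.norm_eq_abs] using h1
    _ = ∫ s, |k s| := integral_sub_left_eq_self (fun s => |k s|) volume T

/-- Hence BOUNDED DISCREPANCY: the integer count `⌊Φ + h⌋` of a floor–feedback solution stays within `‖k‖₁ + 1` of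
the model count `Φ` (`⌊G⌋ − Φ = h − fract G`).  In particular no floor–feedback family is the family of ordinates of
`ζ` (whose discrepancy `S(T)` from the smooth count is unbounded). [folklore] -/
theorem abs_floor_sub_le_of_isFloorFeedback {Φ h : ℝ → ℝ} {k : 𝓢(ℝ, ℝ)} (hfb : IsFloorFeedback Φ h k) (T : ℝ) :
    |((⌊Φ T + h T⌋ : ℤ) : ℝ) - Φ T| ≤ (∫ s, |k s|) + 1 := by
  have hh := abs_le_of_isFloorFeedback hfb T
  have hf0 : 0 ≤ Int.fract (Φ T + h T) := Int.fract_nonneg _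
  have hf1 : Int.fract (Φ T + h T) < 1 := Int.fract_lt_one _
  have hdecomp : ((⌊Φ T + h T⌋ : ℤ) : ℝ) - Φ T = h T - Int.fract (Φ T + h T) := by
    rw [Int.fract]
    ring
  rw [hdecomp]
  calc |h T - Int.fract (Φ T + h T)| ≤ |h T| + |Int.fract (Φ T + h T)| := abs_sub _ _
    _ ≤ (∫ s, |k s|) + 1 := by
        rw [abs_of_nonneg hf0]
        linarith

/-! ## The Bernstein floor of an admissible kernel -/

/-- The derivative of a real Schwartz function, pushed to `ℂ`, is the derivative of the pushed function. [folklore] -/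
theorem deriv_ofReal_schwartz (k : 𝓢(ℝ, ℝ)) :
    deriv (fun T : ℝ => ((k T : ℝ) : ℂ)) = fun T : ℝ => ((deriv (fun y : ℝ => k y) T : ℝ) : ℂ) := by
  funext T
  have hk : HasDerivAt (fun y : ℝ => k y) (deriv (fun y : ℝ => k y) T) T :=
    k.differentiableAt.hasDerivAt
  exact (hk.ofReal_comp).deriv

/-- **The Bernstein floor `A ≤ ‖k′‖₁` of an admissible kernel.**  If `𝓕k ≡ 1` on `|w| ≤ A/2π` then
`𝓕(k′)(A/2π) = 2πi (A/2π) 𝓕k(A/2π) = iA`, while `|𝓕(k′)(w)| ≤ ∫ |k′| = slopeBudget k`. (For `A < 0` the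
hypothesis is vacuous and the conclusion trivial.) [folklore] -/
theorem le_slopeBudget_of_isFeedbackKernel {A : ℝ} {k : 𝓢(ℝ, ℝ)} (hk : IsFeedbackKernel A k) :
    A ≤ slopeBudget k := by
  rcases lt_or_ge A 0 with hA | hA
  · exact hA.le.trans (slopeBudget_nonneg k)
  -- the complexified kernel and its derivative
  set f : ℝ → ℂ := fun T => ((k T : ℝ) : ℂ) with hf
  have hfi : Integrable f := (k.integrable (μ := volume)).ofReal
  have hfd : Differentiable ℝ f := fun T => (k.differentiableAt.hasDerivAt.ofReal_comp).differentiableAt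
  have hderiv : deriv f = fun T : ℝ => ((deriv (fun y : ℝ => k y) T : ℝ) : ℂ) := deriv_ofReal_schwartz k
  have hk'i : Integrable (fun T : ℝ => deriv (fun y : ℝ => k y) T) := by
    have := (SchwartzMap.derivCLM ℝ ℝ k).integrable (μ := volume)
    refine this.congr (Eventually.of_forall fun T => ?_)
    simp [SchwartzMap.derivCLM_apply]
  have hf'i : Integrable (deriv f) := by
    rw [hderiv]
    exact hk'i.ofReal
  -- Fourier transform of the derivative at the band edge
  set w : ℝ := A / (2 * π) with hw
  have hwabs : |w| ≤ A / (2 * π) := by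
    rw [abs_of_nonneg (by positivity)]
  have hFk : 𝓕 f w = 1 := hk w hwabs
  have hFd : 𝓕 (deriv f) w = (2 * π * I * w) • 𝓕 f w := by
    rw [Real.fourier_deriv hfi hfd hf'i]
  rw [hFk, smul_eq_mul, mul_one] at hFd
  -- its norm is `A`
  have hnorm : ‖𝓕 (deriv f) w‖ = A := by
    rw [hFd, hw]
    simp only [norm_mul, Complex.norm_real, Complex.norm_I, Real.norm_eq_abs, Complex.norm_ofNat,
      mul_one]
    rw [abs_of_pos Real.pi_pos, abs_of_nonneg (by positivity : (0 : ℝ) ≤ A / (2 * π))]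
    field_simp
  -- and is at most `‖k′‖₁`
  have hle : ‖𝓕 (deriv f) w‖ ≤ ∫ T, ‖deriv f T‖ :=
    VectorFourier.norm_fourierIntegral_le_integral_norm 𝐞 volume (innerₗ ℝ) (deriv f) w
  have hint : ∫ T, ‖deriv f T‖ = slopeBudget k := by
    rw [hderiv]
    unfold slopeBudget
    refine integral_congr_ae (Eventually.of_forall fun T => ?_)
    simp [Complex.norm_real, Real.norm_eq_abs]
  linarith [hnorm.symm.le.trans hle]

/-- **The handover height of ANY quiet datum at level `A` is at least `exp(2π C⋆(A) + π A)`** (Bernstein floor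
`A ≤ ‖k′‖₁` inside `quietHeight A k = max(floorHeight A, exp(2π C⋆(A) + π‖k′‖₁))`); at `A = log 2` this is
`2π e^{π/5} 2^π ≥ 104`. [folklore] -/
theorem exp_le_quietHeight_of_isFeedbackKernel {A : ℝ} {k : 𝓢(ℝ, ℝ)} (hk : IsFeedbackKernel A k) :
    Real.exp (2 * π * floorConst A + π * A) ≤ quietHeight A k := by
  have hB := le_slopeBudget_of_isFeedbackKernel hk
  unfold quietHeight
  refine le_trans ?_ (exp_le_handover _ _ _)
  gcongr

/-- Registered helper `quietHeight_floor` (name-keyed statement, definition-free in the constants): for every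
admissible kernel the quiet zone `[-T₁, T₁]` of `QuietRung A` contains `[-e^{2πC⋆(A)+πA}, e^{2πC⋆(A)+πA}]`.
[folklore] -/
theorem quietHeight_floor :
    ∀ (A : ℝ) (k : 𝓢(ℝ, ℝ)), IsFeedbackKernel A k →
      Real.exp (2 * π * floorConst A + π * A) ≤ quietHeight A k :=
  fun _ _ hk => exp_le_quietHeight_of_isFeedbackKernel hk

end Summit.RiemannHypothesis.RiemannHypothesis.Theorems.FloorFeedback

end
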